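import Literature.NumberTheory.Automorphic.AutomorphicRepOfForm
import Literature.NumberTheory.Automorphic.AutomorphicRepCuspidalPart
import Literature.NumberTheory.Automorphic.AutomorphicRepsGLCuspidalL2Step2Holds
import Literature.NumberTheory.Automorphic.AutomorphicRepsGLCuspidalL2Step4
import Literature.NumberTheory.Automorphic.GLnCuspidalSpectrumDiscreteProofs
import Literature.NumberTheory.Automorphic.HeckeEigenvectorProjection
import Literature.NumberTheory.Automorphic.AdelicGroupDataAutomorphicMeasureProofs
import HarnessLib

/-!
# Constructors of cuspidal automorphic representation data of `GL_n(𝔸_K)` (Borel–Jacquet model):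
# the representation generated by a cusp form, by an irreducible `Π ≤ L²_cusp`, by one cusp function

Topic `NumberTheory/Automorphic`; namespace `Literature.NumberTheory.Automorphic`. Definitions with
bodies (no `sorry`, no named fact, no instance) answering the construction request of crux
`stmt-Langlands-13450` (route `SteinbergWeightVelocity`): "a constructor for
`CuspidalAutomorphicRepData n K hcpt` (`n = 2`), an explicit datum".

A term of `CuspidalAutomorphicRepData n K hcpt` (`AutomorphicRepsGL`: an automorphic representation
datum `π = W / W'` of the `GL_n` automorphy datum — `W' < W` stable spaces of automorphic forms with no
stable space strictly in between — realised on cusp forms, `W ≤ 𝒜₀ = cuspFormsGL n K hcpt`;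
Borel–Jacquet 1979, 4.6) is manufactured here from each of the following inputs, using only theorems
of the tree:

1. `CuspidalAutomorphicRepData.ofCuspForm` — **from a non-zero cusp form** `0 ≠ φ ∈ 𝒜₀`: the cuspidal
   automorphic representation GENERATED by `φ` (Langlands 1979, proof of Prop. 2; Borel–Jacquet 1979,
   4.6): `W` is the stable closure of `φ` in `𝒜₀` (the smallest stable space containing `φ`,
   `W_ofCuspForm_le`) and `W'` a maximal stable subspace of `W` missing `φ`
   (`IsStableSubmodule.exists_automorphicRepData_of_mem` of `AutomorphicRepOfForm`, applied to the
   stable space `𝒜₀`, `isStableSubmodule_cuspFormsGL` of `AutomorphicRepCuspidalPart`). API: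
   `mem_W_ofCuspForm`, `not_mem_W'_ofCuspForm`, `W_ofCuspForm_le`, and
   `hasSatakeParamAt_ofCuspForm_of_eigenvector` (a `K(𝔫)`-fixed Hecke eigenform `φ` exhibits its
   Satake parameters on the datum it generates). For `n = 2` the cusp condition is the single Borel
   constant term: `isCuspFormGL_two_iff`, `CuspidalAutomorphicRepData.ofFormGL2` (an automorphic form on
   `GL₂(𝔸_K)` with vanishing constant term along `B`).
2. `CuspidalAutomorphicRepData.ofL2` — **from an irreducible closed invariant
   `Π ≤ L²_cusp(GL_n(𝔸_K) ⧸ A_G GL_n(K), μ)`** (`CuspidalAutomorphicRepGL n K μ`): the space `V_Π` of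
   automorphic forms `g ↦ f [g⁻¹]`, `[f] ∈ Π`, is non-zero (`AutomorphicRepsGL.formsOfL2_ne_bot_holds`,
   Borel–Jacquet 4.6 Step 1, a theorem of the tree) and consists of cusp forms
   (`AutomorphicRepsGL.formsOfL2_le_cuspFormsGL`, Step 4); generate by a non-zero element. Since `V_Π`
   is stable (`AutomorphicRepsGL.formsOfL2_isStableSubmodule_holds`, Step 2) the datum is realised
   INSIDE `V_Π` (`W_ofL2_le_formsOfL2`).
3. `CuspidalAutomorphicRepData.ofCuspidalSubspaceNeBot` — **from `L²_cusp ≠ 0`**: `L²_cusp` is the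
   closed span of its irreducible closed subrepresentations
   (`GLnCuspidalSpectrum.isDiscretelyDecomposable_cuspidal_holds`, Gelfand–Graev–Piatetski-Shapiro,
   a theorem of the tree), so a non-zero vector has a non-zero projection onto some irreducible
   `Π ≤ L²_cusp` (`ClosedSubrep.exists_isTopIrreducible_orthogonalProjectionOnto_ne_zero`, Bump 1997,
   proof of Thm. 3.6.1), `nonempty_cuspidalAutomorphicRepGL_of_ne_bot`; then 2.
4. `CuspidalAutomorphicRepData.ofContinuousCuspForm` — **from ONE non-zero continuous square-integrable
   cusp function** `f` on `GL_n(𝔸_K) ⧸ A_G GL_n(K)` (`IsContinuousCuspForm n K μ f`, `f ≠ 0`): its class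
   lies in `L²_cusp` (`mem_cuspidalSubspace_of_isContinuousCuspForm`) and is non-zero because an
   automorphic measure charges open sets (`cuspidalSubspace_ne_bot_of_isContinuousCuspForm`); then 3.
   For `n = 2`: `CuspidalAutomorphicRepData.ofContinuousCuspFunctionGL2` (continuity, `f ∈ ℒ²(μ)`,
   vanishing constant term along `B`, `f ≠ 0`).
5. Sanity (non-vacuity of the whole chain): `CuspidalAutomorphicRepData.nonempty_one` — for `n = 1`
   the parabolic condition is empty, the constant function `1` is a non-zero continuous cusp function
   for any automorphic measure (`AdelicGroupData.exists_isAutomorphicMeasure_gl_holds`), so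
   `CuspidalAutomorphicRepData 1 K hcpt` is inhabited for every number field `K`.

## What this does NOT provide (state of the tree, recorded for the planner of stmt-Langlands-13450)

By 1–4, an inhabitant of `CuspidalAutomorphicRepData n K hcpt` for `n ≥ 2` exists in the tree as soon
as ONE non-zero cusp form — equivalently one non-zero continuous `L²` cusp function — on `GL_n(𝔸_K)`
is exhibited; everything downstream (Harish-Chandra, Gelfand–Piatetski-Shapiro, Langlands' generated
representation) is proved. No such function is constructed anywhere in the tree or in Mathlib for any
`n ≥ 2` and any `K` (over `ℚ` the adelisation of a classical newform is the named fact
`Gelbart1975_exists_adelicNewform`; automorphic induction, base change and the modularity theorems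
that would produce cuspidal `π` on `GL₂` over a CM field are named facts). Moreover the hypotheses of
`WeightVelocity` require `π.1.IsRegularAlgebraic` (an honest infinitesimal-character condition,
`HasHCParameter`), which no soft-analytic construction can certify: a regular algebraic cuspidal `π`
on `GL₂` over a CM field needs an arithmetic existence theorem. So these constructors reduce, but do
not discharge, the object wanted by the refuters of `stmt-Langlands-13450`.

## References

* R. P. Langlands, *On the notion of an automorphic representation*, Proc. Sympos. Pure Math. 33
  (Corvallis 1977), Part 1 (1979), 203–207: proof of Prop. 2 [LanglandsCorvallis1979Notion].
* A. Borel, H. Jacquet, *Automorphic forms and automorphic representations*, ibid., 189–202, §4.4,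
  §4.6 [BorelJacquet1979].
* I. M. Gelfand, M. I. Graev, I. I. Piatetski-Shapiro, *Representation theory and automorphic
  functions* (1969), Ch. 3 [GelfandGraevPiatetskiShapiro1969].
* D. Bump, *Automorphic Forms and Representations* (1997), Thm. 3.3.2 and proof of Thm. 3.6.1
  (pp. 340–342) [Bump1997].
-/

noncomputable section

open scoped MatrixGroups Classical
open NumberField IsDedekindDomain
open _root_.MeasureTheory

namespace Literature.NumberTheory.Automorphic

variable {n : ℕ} {K : Type} [Field K] [NumberField K] {hcpt : isCompact_glFiniteIntegralLevel n K}

namespace CuspidalAutomorphicRepData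

/-! ### 1. The cuspidal automorphic representation generated by a non-zero cusp form -/

section OfCuspForm

/-- **The cuspidal automorphic representation generated by a non-zero cusp form** (Langlands 1979,
proof of Prop. 2; Borel–Jacquet 1979, 4.6). For `0 ≠ φ ∈ 𝒜₀(GL_n(K) \ GL_n(𝔸_K))`
(`cuspFormsGL n K hcpt`; its elements are exactly the cusp forms, `isCuspFormGL_of_mem_cuspFormsGL'`)
the datum `π_φ = W / W'` with `W` the stable closure of `φ` in the `(𝔤, K_∞) × GL_n(𝔸_K^∞)`-stable
space `𝒜₀` (`isStableSubmodule_cuspFormsGL`) and `W'` a maximal stable subspace of `W` not containing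
`φ` (`IsStableSubmodule.exists_automorphicRepData_of_mem`); it is cuspidal since `W ≤ 𝒜₀`.
[cite: LanglandsCorvallis1979Notion, proof of Prop. 2] [cite: BorelJacquet1979, 4.6] -/
def ofCuspForm {φ : (AdelicGroupData.gl n K).Adelic → ℂ} (hφ : φ ∈ cuspFormsGL n K hcpt)
    (hφ0 : φ ≠ 0) : CuspidalAutomorphicRepData n K hcpt :=
  ⟨Classical.choose ((isStableSubmodule_cuspFormsGL hcpt).exists_automorphicRepData_of_mem hφ hφ0),
    (Classical.choose_spec
      ((isStableSubmodule_cuspFormsGL hcpt).exists_automorphicRepData_of_mem hφ hφ0)).2.2.1⟩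

variable {φ : (AdelicGroupData.gl n K).Adelic → ℂ} (hφ : φ ∈ cuspFormsGL n K hcpt) (hφ0 : φ ≠ 0)

/-- The generating cusp form lies in `W`. Borel–Jacquet 1979, 4.6. [cite: BorelJacquet1979, 4.6] -/
theorem mem_W_ofCuspForm : φ ∈ (ofCuspForm hφ hφ0).1.W :=
  (Classical.choose_spec
    ((isStableSubmodule_cuspFormsGL hcpt).exists_automorphicRepData_of_mem hφ hφ0)).1

/-- The generating cusp form does not lie in `W'`, i.e. its class in `W / W'` is non-zero.
Borel–Jacquet 1979, 4.6. [cite: BorelJacquet1979, 4.6] -/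
theorem not_mem_W'_ofCuspForm : φ ∉ (ofCuspForm hφ hφ0).1.W' :=
  (Classical.choose_spec
    ((isStableSubmodule_cuspFormsGL hcpt).exists_automorphicRepData_of_mem hφ hφ0)).2.1

/-- `W` is the stable closure of `φ`: it is contained in every stable space of automorphic forms
containing `φ`. Langlands 1979, proof of Prop. 2. [cite: LanglandsCorvallis1979Notion, proof of Prop. 2] -/
theorem W_ofCuspForm_le {S : Submodule ℂ ((AdelicGroupData.gl n K).Adelic → ℂ)}
    (hS : IsStableSubmodule (AutomorphyDatum.gl n K hcpt) S) (hφS : φ ∈ S) :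
    (ofCuspForm hφ hφ0).1.W ≤ S :=
  (Classical.choose_spec
    ((isStableSubmodule_cuspFormsGL hcpt).exists_automorphicRepData_of_mem hφ hφ0)).2.2.2 S hS hφS

/-- The forms of the generated datum are cusp forms (`W ≤ 𝒜₀`). Borel–Jacquet 1979, 4.6.
[cite: BorelJacquet1979, 4.6] -/
theorem W_ofCuspForm_le_cuspFormsGL : (ofCuspForm hφ hφ0).1.W ≤ cuspFormsGL n K hcpt :=
  (ofCuspForm hφ hφ0).2

/-- `W' < W` for the generated datum (restated from the structure, for convenience). [folklore] -/
theorem W'_lt_W_ofCuspForm : (ofCuspForm hφ hφ0).1.W' < (ofCuspForm hφ hφ0).1.W :=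
  (ofCuspForm hφ hφ0).1.lt

/-- **A Hecke eigenform exhibits its Satake parameters on the representation it generates.** If the
non-zero cusp form `φ` is fixed by `K(𝔫)` (`𝔫 ≠ 0` prime to `v`) and is an eigenvector of the Hecke
operators `[K(𝔫) t_{v,i} K(𝔫)]`, `i ≤ n`, with eigenvalues `q_v^{i(n-i)/2} e_i(α)` (`card α = n`, `ϖ` a
uniformizer at `v`), then `π_φ` has Satake parameter `α` at `v`
(`AutomorphicRepData.hasSatakeParamAt_of_eigenvector` with `φ ∈ W ∖ W'`). Borel–Jacquet 1979, 4.6;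
Bump 1997, §3.3. [cite: BorelJacquet1979, 4.6] -/
theorem hasSatakeParamAt_ofCuspForm_of_eigenvector {v : HeightOneSpectrum (𝓞 K)} {α : Multiset ℂ}
    {𝔫 : Ideal (𝓞 K)} {ϖ : (v.adicCompletion K)ˣ} (h𝔫 : 𝔫 ≠ 0) (hv : ¬ v.asIdeal ∣ 𝔫)
    (hϖ : Valued.v (ϖ : v.adicCompletion K) = WithZero.exp (-1 : ℤ)) (hα : Multiset.card α = n)
    (hfix : ∀ u ∈ principalCongruenceLevel n K 𝔫, rightTranslation (AdelicGroupData.gl n K) u φ = φ)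
    (heig : ∀ i ≤ n, heckeOperator (rightTranslation (AdelicGroupData.gl n K))
        (principalCongruenceLevel n K 𝔫) (heckeDiagAt n K v ϖ i) φ =
      ((((Real.sqrt (v.residueCard : ℝ)) : ℝ) : ℂ) ^ (i * (n - i)) * α.esymm i) • φ) :
    (ofCuspForm hφ hφ0).1.HasSatakeParamAt v α :=
  (ofCuspForm hφ hφ0).1.hasSatakeParamAt_of_eigenvector h𝔫 hv hϖ hα (mem_W_ofCuspForm hφ hφ0)
    (not_mem_W'_ofCuspForm hφ hφ0) hfix heig

end OfCuspForm

/-! ### 2. `n = 2`: an automorphic form on `GL₂(𝔸_K)` with vanishing constant term along `B` -/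

section GL2

/-- For `GL₂` the only proper standard parabolic is the Borel `B = P₁`: `φ` is a cusp form iff it is an
automorphic form whose constant term along `B` vanishes. Borel–Jacquet 1979, 4.4.
[cite: BorelJacquet1979, 4.4] -/
theorem isCuspFormGL_two_iff {hcpt : isCompact_glFiniteIntegralLevel 2 K}
    {φ : (AdelicGroupData.gl 2 K).Adelic → ℂ} :
    IsCuspFormGL 2 K hcpt φ ↔
      IsAutomorphicForm (AutomorphyDatum.gl 2 K hcpt) φ ∧ CuspConditionGL 2 K φ 1 := by
  constructor
  · rintro ⟨h, hc⟩
    exact ⟨h, hc 1 one_pos one_lt_two⟩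
  · rintro ⟨h, hc⟩
    refine ⟨h, fun k hk hk2 => ?_⟩
    obtain rfl : k = 1 := by omega
    exact hc

/-- **The explicit `GL₂` constructor.** A non-zero automorphic form `φ` on `GL₂(𝔸_K)` (Borel–Jacquet
4.2) whose constant term along the Borel subgroup vanishes (`CuspConditionGL 2 K φ 1`:
`∫_{N(K)\N(𝔸_K)} φ(u g) du = 0` for all `g`) generates a cuspidal automorphic representation datum of
`GL₂(𝔸_K)` containing `φ` in `W ∖ W'` (`ofCuspForm`). Borel–Jacquet 1979, 4.4 and 4.6.
[cite: BorelJacquet1979, 4.6] -/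
def ofFormGL2 {hcpt : isCompact_glFiniteIntegralLevel 2 K} {φ : (AdelicGroupData.gl 2 K).Adelic → ℂ}
    (hφ : IsAutomorphicForm (AutomorphyDatum.gl 2 K hcpt) φ) (hc : CuspConditionGL 2 K φ 1)
    (hφ0 : φ ≠ 0) : CuspidalAutomorphicRepData 2 K hcpt :=
  ofCuspForm (isCuspFormGL_two_iff.2 ⟨hφ, hc⟩).mem_cuspFormsGL hφ0

/-- The form `φ` lies in `W ∖ W'` of the `GL₂` datum it generates. Borel–Jacquet 1979, 4.6.
[cite: BorelJacquet1979, 4.6] -/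
theorem mem_W_not_mem_W'_ofFormGL2 {hcpt : isCompact_glFiniteIntegralLevel 2 K}
    {φ : (AdelicGroupData.gl 2 K).Adelic → ℂ} (hφ : IsAutomorphicForm (AutomorphyDatum.gl 2 K hcpt) φ)
    (hc : CuspConditionGL 2 K φ 1) (hφ0 : φ ≠ 0) :
    φ ∈ (ofFormGL2 hφ hc hφ0).1.W ∧ φ ∉ (ofFormGL2 hφ hc hφ0).1.W' :=
  ⟨mem_W_ofCuspForm _ _, not_mem_W'_ofCuspForm _ _⟩

end GL2

/-! ### 3. From an irreducible closed invariant subspace `Π ≤ L²_cusp` -/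

section OfL2

variable {μ : Measure (AdelicGroupData.gl n K).automorphicQuotient}
  [(AdelicGroupData.gl n K).IsAutomorphicMeasure μ]

variable (hcpt) in
/-- A cuspidal `Π ≤ L²_cusp(GL_n(𝔸_K) ⧸ A_G GL_n(K), μ)` contains a non-zero automorphic form
`g ↦ f [g⁻¹]`, `[f] ∈ Π` (`V_Π ≠ 0`: `AutomorphicRepsGL.formsOfL2_ne_bot_holds`, Borel–Jacquet 1979,
4.6, Step 1). [cite: BorelJacquet1979, 4.6] -/
theorem exists_mem_formsOfL2_ne_zero (P : CuspidalAutomorphicRepGL n K μ) :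
    ∃ φ ∈ formsOfL2 hcpt μ P.1, φ ≠ 0 :=
  Submodule.exists_mem_ne_zero_of_ne_bot (AutomorphicRepsGL.formsOfL2_ne_bot_holds hcpt μ P)

variable (hcpt) in
/-- **The Borel–Jacquet datum of a cuspidal `L²` representation.** For an irreducible closed invariant
`Π ≤ L²_cusp(GL_n(𝔸_K) ⧸ A_G GL_n(K), μ)` (`CuspidalAutomorphicRepGL n K μ`): the cuspidal automorphic
representation datum generated (`ofCuspForm`) by a non-zero element of the space `V_Π` of automorphic
forms `g ↦ f [g⁻¹]`, `[f] ∈ Π` (`exists_mem_formsOfL2_ne_zero`; `V_Π ≤ 𝒜₀`,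
`AutomorphicRepsGL.formsOfL2_le_cuspFormsGL`). Borel–Jacquet 1979, 4.6. [cite: BorelJacquet1979, 4.6] -/
def ofL2 (P : CuspidalAutomorphicRepGL n K μ) : CuspidalAutomorphicRepData n K hcpt :=
  ofCuspForm
    (AutomorphicRepsGL.formsOfL2_le_cuspFormsGL P.le_cuspidalSubspace
      (Classical.choose_spec (exists_mem_formsOfL2_ne_zero hcpt P)).1)
    (Classical.choose_spec (exists_mem_formsOfL2_ne_zero hcpt P)).2

variable (hcpt) in
/-- The datum `ofL2 hcpt Π` is realised inside `V_Π`: `W ≤ formsOfL2 hcpt μ Π` (`V_Π` is stable,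
`AutomorphicRepsGL.formsOfL2_isStableSubmodule_holds`, Borel–Jacquet 4.6 Step 2, and `W` is the stable
closure of an element of `V_Π`). [cite: BorelJacquet1979, 4.6] -/
theorem W_ofL2_le_formsOfL2 (P : CuspidalAutomorphicRepGL n K μ) :
    (ofL2 hcpt P).1.W ≤ formsOfL2 hcpt μ P.1 :=
  W_ofCuspForm_le _ _ (AutomorphicRepsGL.formsOfL2_isStableSubmodule_holds hcpt μ P)
    (Classical.choose_spec (exists_mem_formsOfL2_ne_zero hcpt P)).1

variable (hcpt) in
/-- Some non-zero automorphic form of `V_Π` lies in `W ∖ W'` of `ofL2 hcpt Π`. Borel–Jacquet 1979, 4.6.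
[cite: BorelJacquet1979, 4.6] -/
theorem exists_mem_formsOfL2_mem_W_not_mem_W'_ofL2 (P : CuspidalAutomorphicRepGL n K μ) :
    ∃ φ ∈ formsOfL2 hcpt μ P.1, φ ≠ 0 ∧ φ ∈ (ofL2 hcpt P).1.W ∧ φ ∉ (ofL2 hcpt P).1.W' :=
  ⟨_, (Classical.choose_spec (exists_mem_formsOfL2_ne_zero hcpt P)).1,
    (Classical.choose_spec (exists_mem_formsOfL2_ne_zero hcpt P)).2, mem_W_ofCuspForm _ _,
    not_mem_W'_ofCuspForm _ _⟩

/-! ### 4. From `L²_cusp ≠ 0` (discreteness of the cuspidal spectrum) -/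

omit [(AdelicGroupData.gl n K).IsAutomorphicMeasure μ] in
/-- **A non-zero cuspidal subspace contains a cuspidal automorphic representation**: `L²_cusp` is the
closed span of its irreducible closed subrepresentations
(`GLnCuspidalSpectrum.isDiscretelyDecomposable_cuspidal_holds`, Gelfand–Graev–Piatetski-Shapiro), so a
non-zero vector of `L²_cusp` projects non-trivially onto some irreducible `Π ≤ L²_cusp`
(`ClosedSubrep.exists_isTopIrreducible_orthogonalProjectionOnto_ne_zero`; Bump 1997, proof of
Thm. 3.6.1). [cite: GelfandGraevPiatetskiShapiro1969, Ch. 3] [cite: Bump1997, Thm. 3.6.1 (proof, p. 340)] -/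
theorem nonempty_cuspidalAutomorphicRepGL_of_ne_bot [(AdelicGroupData.gl n K).IsAutomorphicMeasure μ]
    (h : cuspidalSubspace n K μ ≠ ⊥) : Nonempty (CuspidalAutomorphicRepGL n K μ) := by
  have hnt : Nontrivial (cuspidalSubspace n K μ).toSubmodule :=
    (ContRepresentation.ClosedSubrep.ne_bot_iff_nontrivial _).1 h
  obtain ⟨φ, hφ, hφ0⟩ :=
    Submodule.exists_mem_ne_zero_of_ne_bot (Submodule.nontrivial_iff_ne_bot.1 hnt)
  obtain ⟨W, hWC, hirr, -⟩ :=
    ContRepresentation.ClosedSubrep.exists_isTopIrreducible_orthogonalProjectionOnto_ne_zero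
      (cuspidalSubspace n K μ) (GLnCuspidalSpectrum.isDiscretelyDecomposable_cuspidal_holds n K μ)
      (ContRepresentation.ClosedSubrep.mem_toSubmodule.1 hφ) hφ0
  exact ⟨⟨W, hWC, hirr⟩⟩

variable (hcpt) in
/-- **A cuspidal datum from `L²_cusp ≠ 0`.** If `L²_cusp(GL_n(𝔸_K) ⧸ A_G GL_n(K), μ) ≠ 0` then
`GL_n(𝔸_K)` has a cuspidal automorphic representation datum: `ofL2` of an irreducible constituent
(`nonempty_cuspidalAutomorphicRepGL_of_ne_bot`). Borel–Jacquet 1979, 4.6; Gelfand–Graev–Piatetski-Shapiro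
1969, Ch. 3. [cite: BorelJacquet1979, 4.6] -/
def ofCuspidalSubspaceNeBot (h : cuspidalSubspace n K μ ≠ ⊥) : CuspidalAutomorphicRepData n K hcpt :=
  ofL2 hcpt (Classical.choice (nonempty_cuspidalAutomorphicRepGL_of_ne_bot h))

/-! ### 5. From one non-zero continuous square-integrable cusp function -/

/-- **One non-zero continuous `L²` cusp function makes `L²_cusp ≠ 0`.** If `f` is a continuous
square-integrable function on `GL_n(𝔸_K) ⧸ A_G GL_n(K)` all of whose constant terms along the proper
standard maximal parabolics vanish (`IsContinuousCuspForm n K μ f`) and `f ≠ 0`, then its class is a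
non-zero element of `L²_cusp` (`mem_cuspidalSubspace_of_isContinuousCuspForm`; an automorphic measure
charges open sets, so a continuous function with zero class vanishes, Mathlib
`Continuous.ae_eq_iff_eq`). Borel–Jacquet 1979, 4.4–4.6. [cite: BorelJacquet1979, 4.6] -/
theorem cuspidalSubspace_ne_bot_of_isContinuousCuspForm
    {f : (AdelicGroupData.gl n K).automorphicQuotient → ℂ} (hf : IsContinuousCuspForm n K μ f)
    (hf0 : f ≠ 0) : cuspidalSubspace n K μ ≠ ⊥ := by
  have hmem := mem_cuspidalSubspace_of_isContinuousCuspForm hf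
  have hne : hf.memLp.toLp f ≠ 0 := by
    intro h0
    apply hf0
    have h1 : hf.memLp.toLp f =
        (MemLp.zero : MemLp (0 : (AdelicGroupData.gl n K).automorphicQuotient → ℂ) 2 μ).toLp 0 := by
      rw [h0, MemLp.toLp_zero]
    have h2 : f =ᵐ[μ] (0 : (AdelicGroupData.gl n K).automorphicQuotient → ℂ) :=
      (MemLp.toLp_eq_toLp_iff _ _).1 h1
    exact (Continuous.ae_eq_iff_eq μ hf.1 continuous_const).1 h2
  intro hbot
  apply hne
  rw [hbot] at hmem
  exact ContRepresentation.ClosedSubrep.mem_bot.1 hmem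

variable (hcpt) in
/-- **A cuspidal datum from one cusp function.** A non-zero continuous square-integrable cusp function
`f` on `GL_n(𝔸_K) ⧸ A_G GL_n(K)` yields a cuspidal automorphic representation datum of `GL_n(𝔸_K)`
(`cuspidalSubspace_ne_bot_of_isContinuousCuspForm` and `ofCuspidalSubspaceNeBot`). Borel–Jacquet 1979,
4.4–4.6; Gelfand–Graev–Piatetski-Shapiro 1969, Ch. 3. [cite: BorelJacquet1979, 4.6] -/
def ofContinuousCuspForm {f : (AdelicGroupData.gl n K).automorphicQuotient → ℂ}
    (hf : IsContinuousCuspForm n K μ f) (hf0 : f ≠ 0) : CuspidalAutomorphicRepData n K hcpt :=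
  ofCuspidalSubspaceNeBot hcpt (cuspidalSubspace_ne_bot_of_isContinuousCuspForm hf hf0)

end OfL2

section GL2L2

variable {μ : Measure (AdelicGroupData.gl 2 K).automorphicQuotient}
  [(AdelicGroupData.gl 2 K).IsAutomorphicMeasure μ]

/-- **The `GL₂` constructor on the `L²` side.** A non-zero continuous `f ∈ ℒ²(GL₂(𝔸_K) ⧸ A_G GL₂(K), μ)`
whose constant term along the Borel subgroup vanishes (`ConstantTermVanishes 2 K f 1`:
`∫_{N(K)\N(𝔸_K)} f(x u) du = 0` for every `x`) yields a cuspidal automorphic representation datum of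
`GL₂(𝔸_K)` (`ofContinuousCuspForm`; for `n = 2` the Borel is the only proper standard parabolic).
Borel–Jacquet 1979, 4.4–4.6. [cite: BorelJacquet1979, 4.6] -/
def ofContinuousCuspFunctionGL2 (hcpt : isCompact_glFiniteIntegralLevel 2 K)
    {f : (AdelicGroupData.gl 2 K).automorphicQuotient → ℂ} (hf : Continuous f) (hf2 : MemLp f 2 μ)
    (hc : ConstantTermVanishes 2 K f 1) (hf0 : f ≠ 0) : CuspidalAutomorphicRepData 2 K hcpt :=
  ofContinuousCuspForm hcpt
    (⟨hf, hf2, fun k hk hk2 => by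
      obtain rfl : k = 1 := by omega
      exact hc⟩ : IsContinuousCuspForm 2 K μ f) hf0

end GL2L2

/-! ### 6. Sanity: the chain is non-vacuous (`n = 1`) -/

section One

/-- For `GL₁` there is no proper parabolic: the constant function `1` on the compact quotient
`𝔸_Kˣ ⧸ ℝ_{>0} Kˣ` is a non-zero continuous square-integrable cusp function for any automorphic
(finite) measure. Borel–Jacquet 1979, 4.4. [cite: BorelJacquet1979, 4.4] -/
theorem isContinuousCuspForm_one_const (μ : Measure (AdelicGroupData.gl 1 K).automorphicQuotient)
    [(AdelicGroupData.gl 1 K).IsAutomorphicMeasure μ] :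
    IsContinuousCuspForm 1 K μ (fun _ => (1 : ℂ)) :=
  ⟨continuous_const, memLp_const 1, fun k hk hk1 => by omega⟩

/-- **`CuspidalAutomorphicRepData 1 K hcpt` is inhabited for every number field `K`** (non-vacuity of
the constructors of this file): an automorphic measure on `GL₁(𝔸_K) ⧸ A_G GL₁(K)` exists
(`AdelicGroupData.exists_isAutomorphicMeasure_gl_holds`), the constant `1` is a non-zero continuous
cusp function (`isContinuousCuspForm_one_const`), whence a datum by `ofContinuousCuspForm`.
Borel–Jacquet 1979, 4.4–4.6. [cite: BorelJacquet1979, 4.6] -/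
theorem nonempty_one (hcpt : isCompact_glFiniteIntegralLevel 1 K) :
    Nonempty (CuspidalAutomorphicRepData 1 K hcpt) := by
  obtain ⟨μ, hμ⟩ := AdelicGroupData.exists_isAutomorphicMeasure_gl_holds 1 K
  have h0 : (fun _ : (AdelicGroupData.gl 1 K).automorphicQuotient => (1 : ℂ)) ≠ 0 := by
    intro h
    have h1 := congrFun h ((AdelicGroupData.gl 1 K).toAutomorphicQuotient 1)
    exact one_ne_zero h1
  exact ⟨ofContinuousCuspForm hcpt (isContinuousCuspForm_one_const μ) h0⟩

end One

end CuspidalAutomorphicRepData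

end Literature.NumberTheory.Automorphic

end
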